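import Summits.HodgeConjecture.HodgeConjecture.Theorems.R90S2ArchCuspPinDefs     -- ★ p864254 FILE 1: `embPlace`, `IsArchFactoredAtPlace(₂)`, `IsArchTraceCuspidal`, `CuspG₀`, `CuspH₀`, `phi2`, `phi1`; brings ★ `phi3`, `GArch`, `HArch`, `ArchOrbFamG∕H`
import Summits.HodgeConjecture.HodgeConjecture.Theorems.R90S2ArchPureTensor      -- ★ p864344 CARD 2: `archTensor`, `archTensorAway`, `archTensor_factorsAt`, `archTensor_update_factorsAt`, `archTensor_update_sub` (+ `₂` twins)
import HarnessLib

/-!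
# R90-TF ∕ S2 «Ch. 12 archimedean block» — CARD 5 `R90S2ArchTensorCuspPin`: the (g)-CUSP GLUE — pure tensors of trace-cuspidal local factors satisfy the pins `CuspG₀` ∕ `CuspH₀`

Cell `pub/hodgecm-mathlib`, HCML Track R90-TF, section S2 (base `R90-C11`); crux h413 = `stmt-HodgeConjecture-24833`, route of record `HCCMUnconditional`.
Hand: prover seat hodgecm-mathlib-K2E3-p25 (g5); dealer K2E1b-plan (g8) CARD 5 (K2 bus 2026-09-05T01:56:31Z, heads A1–A5); auditor R90-C11-audit1 (g2) (its CARD 2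
junction examples J-C2-1…7 are exactly §0–§2 below, now BY NAME).  THEOREMS ONLY (proof lane); NO def, NO socket, NO instance, NO notation, NO `sorry`, default
heartbeats.  E-grade: ★ FILE 1 `R90S2ArchCuspPinDefs` (p864254) + ★ CARD 2 `R90S2ArchPureTensor` (p864344) by name — no printed input.

## WHAT IS PROVED

* §0 FILE-1 CURRENCY OF CARD 2 (A5, generic `N H`): `isArchFactoredAtPlace_archTensor` — `⊗ φ` factors at EVERY complex place `w` in ★ `IsArchFactoredAtPlace` currency
  (definitional one-liner over ★ `archTensor_factorsAt`); `isArchFactoredAtPlace_archTensor_update` (the `w`-component replaced); the `H_∞` twins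
  `isArchFactoredAtPlace₂_archTensor₂(_update)` at ★ `phi2 ∕ phi1` (★ `IsArchFactoredAtPlace₂`).
* §1 THE LOCAL PIN UNDER ONE-PLACE SURGERY: `isArchTraceCuspidal_update` — if `ψ` and every `φ_i`, `i ≠ u`, are trace-cuspidal then so is every component of
  `Function.update φ u ψ` (any index type, any family of local groups).
* §2 G-SIDE (`G_∞ = U(Φ₃)_∞ = GArch L`): **A1 `cuspG₀_archTensor`** — a pure tensor whose `mk ι`-component is trace-cuspidal IS `CuspG₀ L m ι` (anonymous constructor:
  `fτ := φ (embPlace L ι)`, `fc := archTensorAway …`, factorisation ★ `archTensor_factorsAt`); A1′ `cuspG₀_archTensor_forall` (all factors trace-cuspidal ⇒ the pin at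
  EVERY `ι`); `cuspG₀_archTensor_update` ∕ `cuspG₀_archTensor_update_self`; **A2 `cuspG₀_archTensor_update_sub`** — THE T2 (g) SHAPE: for `f k₁`, `f k₂` pure tensors
  differing at ONE place `u` (`w`-components `ψ₁`, `ψ₂`), `⇑(f k₁ - f k₂)` IS `CuspG₀ L m ι` at every `ι` as soon as `ψ₁ − ψ₂` and the common factors `φ_w`, `w ≠ u`, are
  trace-cuspidal (★ `archTensor_update_sub` + A1); `cuspG₀_archTensor_update_sub_self` (at the surgery place itself: only `ψ₁ − ψ₂` is read).
* §3 H-SIDE (`H_∞ = U(Φ₂)_∞ × U(Φ₁)_∞ = HArch L`): A3 `cuspH₀_archTensor₂`, A3′ `cuspH₀_archTensor₂_forall`, `cuspH₀_archTensor₂_update(_self)`, **A4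
  `cuspH₀_archTensor₂_update_sub`** (+ `_self`) — verbatim twins over ★ `archTensor₂ L (phi2 L) (phi1 L)` and ★ `CuspH₀`.

CONSUMER BY NAME: typ2's T2 (g) payer ∕ the assembly `R90S2ArchBlockPacketCuspOfLetters` (PAYMENT-ROADS-S2.v1 §1): the conjuncts `∀ ι, CuspG₀ L mG ι ⇑(f k₁ - f k₂)` and
`∀ ι, CuspH₀ L mH ι ⇑fH` become one-liners from the letters' outputs «pseudo-coefficients (their one-place differences, their transfers' local factors) are trace-cuspidal».

HONEST LABEL: glue lemmas; they pay NO printed input (whether a given local factor IS trace-cuspidal is the letters' business — Clozel–Delorme ∕ Prop. 12.3.2); HC_CM is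
proved only modulo the 7 printed citations (2 remaining named inputs: hLiu418 = `stmt-HodgeConjecture-24832`, h413 = `stmt-HodgeConjecture-24833`) until rung 0
closes.  Count-neutral helper (`--supports stmt-HodgeConjecture-24833 --as helper`).

References: [Rogawski1990] §13.8 p. 218 L20–28 (proof of Prop. 13.8.3: `f = ⊗ f_w`, `f_u = f_{1u} − f_{2u}` cuspidal), §12.3 Prop. 12.3.2 p. 178;
[Arthur1988InvariantTraceFormulaII] §7 p. 538 (functions cuspidal at a place); [BorelJacquet1979] §4.1.
-/

set_option autoImplicit false
set_option linter.dupNamespace false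

noncomputable section

open MeasureTheory NumberField NumberField.InfinitePlace CompactlySupported
open scoped Matrix MatrixGroups Classical
open Literature.NumberTheory.Automorphic Literature.NumberTheory.Automorphic.UnitaryGroup
open Summit.HodgeConjecture.HodgeConjecture.R90.S10 (phi3 GInf HInf GArch HArch ArchOrbFamG ArchOrbFamH)

namespace Summit.HodgeConjecture.HodgeConjecture.R90.S2

variable (L : Type) [Field L] [NumberField L] [IsCMField L]

/-! ## §0 CARD 2's factorisations in FILE 1 currency (A5) -/

section FileOneCurrency

variable {N : ℕ} (H : Matrix (Fin N) (Fin N) L)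

/-- **A pure tensor factors at EVERY complex place `w`** in ★ `IsArchFactoredAtPlace` currency: `⊗ φ = φ_w ⊗ (⊗_{w' ≠ w} φ_{w'})` (★ `archTensor_factorsAt`, definitional).
[cite: BorelJacquet1979, §4.1] [cite: Arthur1988InvariantTraceFormulaII, §7 p. 538] -/
theorem isArchFactoredAtPlace_archTensor (φ : ∀ w : {w : InfinitePlace L // w.IsComplex}, C_c(↥(archLocal L N H w), ℂ)) (w : {w : InfinitePlace L // w.IsComplex}) :
    IsArchFactoredAtPlace H w ⇑(archTensor L H φ) ⇑(φ w) (archTensorAway L H φ w) :=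
  archTensor_factorsAt L H φ w

/-- The pure tensor with its `w`-component replaced by `ψ` factors at `w` with `w`-component `ψ` and the OLD away factor (★ `archTensor_update_factorsAt`).
[cite: Rogawski1990, §13.8 p. 218 L20–28] [cite: BorelJacquet1979, §4.1] -/
theorem isArchFactoredAtPlace_archTensor_update [DecidableEq {w : InfinitePlace L // w.IsComplex}]
    (φ : ∀ w : {w : InfinitePlace L // w.IsComplex}, C_c(↥(archLocal L N H w), ℂ)) (w : {w : InfinitePlace L // w.IsComplex}) (ψ : C_c(↥(archLocal L N H w), ℂ)) :
    IsArchFactoredAtPlace H w ⇑(archTensor L H (Function.update φ w ψ)) ⇑ψ (archTensorAway L H φ w) :=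
  archTensor_update_factorsAt L H φ w ψ

/-- `H_∞` twin: a two-factor pure tensor over `U(Φ₂) × U(Φ₁)` factors at EVERY complex place in ★ `IsArchFactoredAtPlace₂` currency (★ `archTensor₂_factorsAt` at the
★ `phi2 ∕ phi1` literals, definitional). [cite: BorelJacquet1979, §4.1] [cite: Arthur1988InvariantTraceFormulaII, §7 p. 538] -/
theorem isArchFactoredAtPlace₂_archTensor₂
    (φ₂ : ∀ w : {w : InfinitePlace L // w.IsComplex}, C_c(↥(archLocal L 2 (phi2 L) w) × ↥(archLocal L 1 (phi1 L) w), ℂ)) (w : {w : InfinitePlace L // w.IsComplex}) :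
    IsArchFactoredAtPlace₂ w ⇑(archTensor₂ L (phi2 L) (phi1 L) φ₂) ⇑(φ₂ w) (archTensorAway₂ L (phi2 L) (phi1 L) φ₂ w) :=
  archTensor₂_factorsAt L (phi2 L) (phi1 L) φ₂ w

/-- `H_∞` twin with the `w`-component replaced (★ `archTensor₂_update_factorsAt`). [cite: Rogawski1990, §13.8 p. 218 L20–28] [cite: BorelJacquet1979, §4.1] -/
theorem isArchFactoredAtPlace₂_archTensor₂_update [DecidableEq {w : InfinitePlace L // w.IsComplex}]
    (φ₂ : ∀ w : {w : InfinitePlace L // w.IsComplex}, C_c(↥(archLocal L 2 (phi2 L) w) × ↥(archLocal L 1 (phi1 L) w), ℂ)) (w : {w : InfinitePlace L // w.IsComplex})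
    (ψ : C_c(↥(archLocal L 2 (phi2 L) w) × ↥(archLocal L 1 (phi1 L) w), ℂ)) :
    IsArchFactoredAtPlace₂ w ⇑(archTensor₂ L (phi2 L) (phi1 L) (Function.update φ₂ w ψ)) ⇑ψ (archTensorAway₂ L (phi2 L) (phi1 L) φ₂ w) :=
  archTensor₂_update_factorsAt L (phi2 L) (phi1 L) φ₂ w ψ

end FileOneCurrency

/-! ## §1 The local pin under one-place surgery -/

section Surgery

/-- If `ψ` and every `φ_i`, `i ≠ u`, are trace-cuspidal, then EVERY component of the family `φ` with its `u`-slot replaced by `ψ` is trace-cuspidal.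
[cite: Rogawski1990, §13.8 p. 218 L20–28] -/
theorem isArchTraceCuspidal_update {ι' : Type*} [DecidableEq ι'] {G : ι' → Type*} [∀ i, Group (G i)] [∀ i, TopologicalSpace (G i)]
    (φ : ∀ i, C_c(G i, ℂ)) (u : ι') (ψ : C_c(G u, ℂ)) (hψ : IsArchTraceCuspidal ψ) (hφ : ∀ i, i ≠ u → IsArchTraceCuspidal (φ i)) (i : ι') :
    IsArchTraceCuspidal (Function.update φ u ψ i) := by
  by_cases h : i = u
  · subst h
    rwa [Function.update_self]
  · rw [Function.update_of_ne h]
    exact hφ i h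

end Surgery

/-! ## §2 G-side: pure tensors of trace-cuspidal factors are `CuspG₀` -/

section GSide

/-- **A1 — A PURE TENSOR WITH TRACE-CUSPIDAL `mk ι`-COMPONENT IS `CuspG₀ L m ι`**: `f = ⊗ φ` on `G_∞ = U(Φ₃)_∞` factors at `embPlace L ι` as `φ_ι ⊗ (⊗_{w ≠ ι} φ_w)`
(★ `archTensor_factorsAt`) and the `ι`-component `φ_ι` is trace-cuspidal by hypothesis; the family `m` is not read (★ `CuspG₀` is family-free).
[cite: Rogawski1990, §13.8 p. 218 L20–28] [cite: Arthur1988InvariantTraceFormulaII, §7 p. 538] -/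
theorem cuspG₀_archTensor (m : ArchOrbFamG L) (φ : ∀ w : {w : InfinitePlace L // w.IsComplex}, C_c(↥(archLocal L 3 (phi3 L) w), ℂ)) (ι : L →+* ℂ)
    (hφ : IsArchTraceCuspidal (φ (embPlace L ι))) : CuspG₀ L m ι ⇑(archTensor L (phi3 L) φ) :=
  ⟨φ (embPlace L ι), archTensorAway L (phi3 L) φ (embPlace L ι), archTensor_factorsAt L (phi3 L) φ (embPlace L ι), hφ⟩

/-- **A1′** — a pure tensor ALL of whose local factors are trace-cuspidal is `CuspG₀ L m ι` at EVERY `ι`. [cite: Rogawski1990, §13.8 p. 218 L20–28] -/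
theorem cuspG₀_archTensor_forall (m : ArchOrbFamG L) (φ : ∀ w : {w : InfinitePlace L // w.IsComplex}, C_c(↥(archLocal L 3 (phi3 L) w), ℂ))
    (hφ : ∀ w, IsArchTraceCuspidal (φ w)) : ∀ ι : L →+* ℂ, CuspG₀ L m ι ⇑(archTensor L (phi3 L) φ) :=
  fun ι => cuspG₀_archTensor L m φ ι (hφ _)

/-- The pure tensor with its `u`-component replaced by a trace-cuspidal `ψ` (other factors trace-cuspidal) is `CuspG₀ L m ι` at every `ι`.
[cite: Rogawski1990, §13.8 p. 218 L20–28] -/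
theorem cuspG₀_archTensor_update [DecidableEq {w : InfinitePlace L // w.IsComplex}] (m : ArchOrbFamG L)
    (φ : ∀ w : {w : InfinitePlace L // w.IsComplex}, C_c(↥(archLocal L 3 (phi3 L) w), ℂ)) (u : {w : InfinitePlace L // w.IsComplex})
    (ψ : C_c(↥(archLocal L 3 (phi3 L) u), ℂ)) (hψ : IsArchTraceCuspidal ψ) (hφ : ∀ w, w ≠ u → IsArchTraceCuspidal (φ w)) (ι : L →+* ℂ) :
    CuspG₀ L m ι ⇑(archTensor L (phi3 L) (Function.update φ u ψ)) :=
  cuspG₀_archTensor L m (Function.update φ u ψ) ι (isArchTraceCuspidal_update φ u ψ hψ hφ (embPlace L ι))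

/-- At the surgery place itself (`embPlace L ι = u`) only `ψ` is read: `CuspG₀ L m ι (⊗ update φ u ψ)` from `IsArchTraceCuspidal ψ` alone (witness `fτ := ψ`,
★ `archTensor_update_factorsAt`). [cite: Rogawski1990, §13.8 p. 218 L20–28] -/
theorem cuspG₀_archTensor_update_self [DecidableEq {w : InfinitePlace L // w.IsComplex}] (m : ArchOrbFamG L)
    (φ : ∀ w : {w : InfinitePlace L // w.IsComplex}, C_c(↥(archLocal L 3 (phi3 L) w), ℂ)) (ι : L →+* ℂ)
    (ψ : C_c(↥(archLocal L 3 (phi3 L) (embPlace L ι)), ℂ)) (hψ : IsArchTraceCuspidal ψ) :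
    CuspG₀ L m ι ⇑(archTensor L (phi3 L) (Function.update φ (embPlace L ι) ψ)) :=
  ⟨ψ, archTensorAway L (phi3 L) φ (embPlace L ι), archTensor_update_factorsAt L (phi3 L) φ (embPlace L ι) ψ, hψ⟩

/-- **A2 — THE T2 (g) SHAPE: ONE-PLACE DIFFERENCES OF PURE TENSORS ARE `CuspG₀`** (print's `f = (f_{1u} − f_{2u}) ⊗ ⊗_{w ≠ u} f_w`, proof of Prop. 13.8.3): if the
pure tensors `f k₁ = ⊗ update φ u ψ₁` and `f k₂ = ⊗ update φ u ψ₂` differ at ONE place `u`, `ψ₁ − ψ₂` is trace-cuspidal, and the common factors `φ_w` (`w ≠ u`) are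
trace-cuspidal, then the coerced difference `⇑(f k₁ - f k₂)` is `CuspG₀ L m ι` at EVERY `ι` (★ `archTensor_update_sub` then A1).
[cite: Rogawski1990, §13.8 p. 218 L20–28] [cite: Arthur1988InvariantTraceFormulaII, §7 p. 538] -/
theorem cuspG₀_archTensor_update_sub [DecidableEq {w : InfinitePlace L // w.IsComplex}] (m : ArchOrbFamG L)
    (φ : ∀ w : {w : InfinitePlace L // w.IsComplex}, C_c(↥(archLocal L 3 (phi3 L) w), ℂ)) (u : {w : InfinitePlace L // w.IsComplex})
    (ψ₁ ψ₂ : C_c(↥(archLocal L 3 (phi3 L) u), ℂ)) (hψ : IsArchTraceCuspidal (ψ₁ - ψ₂)) (hφ : ∀ w, w ≠ u → IsArchTraceCuspidal (φ w)) (ι : L →+* ℂ) :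
    CuspG₀ L m ι ⇑(archTensor L (phi3 L) (Function.update φ u ψ₁) - archTensor L (phi3 L) (Function.update φ u ψ₂)) := by
  rw [archTensor_update_sub]
  exact cuspG₀_archTensor_update L m φ u (ψ₁ - ψ₂) hψ hφ ι

/-- A2 at the surgery place itself (`u = embPlace L ι`): only `ψ₁ − ψ₂` is read. [cite: Rogawski1990, §13.8 p. 218 L20–28] -/
theorem cuspG₀_archTensor_update_sub_self [DecidableEq {w : InfinitePlace L // w.IsComplex}] (m : ArchOrbFamG L)
    (φ : ∀ w : {w : InfinitePlace L // w.IsComplex}, C_c(↥(archLocal L 3 (phi3 L) w), ℂ)) (ι : L →+* ℂ)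
    (ψ₁ ψ₂ : C_c(↥(archLocal L 3 (phi3 L) (embPlace L ι)), ℂ)) (hψ : IsArchTraceCuspidal (ψ₁ - ψ₂)) :
    CuspG₀ L m ι ⇑(archTensor L (phi3 L) (Function.update φ (embPlace L ι) ψ₁) - archTensor L (phi3 L) (Function.update φ (embPlace L ι) ψ₂)) := by
  rw [archTensor_update_sub]
  exact cuspG₀_archTensor_update_self L m φ ι (ψ₁ - ψ₂) hψ

end GSide

/-! ## §3 H-side: two-factor pure tensors of trace-cuspidal factors are `CuspH₀` -/

section HSide

/-- **A3 — A TWO-FACTOR PURE TENSOR WITH TRACE-CUSPIDAL `mk ι`-COMPONENT IS `CuspH₀ L m ι`**: `fH = ⊗ φ₂` on `H_∞ = U(Φ₂)_∞ × U(Φ₁)_∞` factors at `embPlace L ι`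
(★ `archTensor₂_factorsAt` at ★ `phi2 ∕ phi1`) with trace-cuspidal `ι`-component `φ₂,ι`; family-free.
[cite: Rogawski1990, §12.3 Prop. 12.3.2 p. 178; §13.8 p. 218 L20–28] [cite: Arthur1988InvariantTraceFormulaII, §7 p. 538] -/
theorem cuspH₀_archTensor₂ (m : ArchOrbFamH L)
    (φ₂ : ∀ w : {w : InfinitePlace L // w.IsComplex}, C_c(↥(archLocal L 2 (phi2 L) w) × ↥(archLocal L 1 (phi1 L) w), ℂ)) (ι : L →+* ℂ)
    (hφ : IsArchTraceCuspidal (φ₂ (embPlace L ι))) : CuspH₀ L m ι ⇑(archTensor₂ L (phi2 L) (phi1 L) φ₂) :=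
  ⟨φ₂ (embPlace L ι), archTensorAway₂ L (phi2 L) (phi1 L) φ₂ (embPlace L ι), archTensor₂_factorsAt L (phi2 L) (phi1 L) φ₂ (embPlace L ι), hφ⟩

/-- **A3′** — all factors trace-cuspidal ⇒ `CuspH₀ L m ι` at EVERY `ι`. [cite: Rogawski1990, §13.8 p. 218 L20–28] -/
theorem cuspH₀_archTensor₂_forall (m : ArchOrbFamH L)
    (φ₂ : ∀ w : {w : InfinitePlace L // w.IsComplex}, C_c(↥(archLocal L 2 (phi2 L) w) × ↥(archLocal L 1 (phi1 L) w), ℂ))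
    (hφ : ∀ w, IsArchTraceCuspidal (φ₂ w)) : ∀ ι : L →+* ℂ, CuspH₀ L m ι ⇑(archTensor₂ L (phi2 L) (phi1 L) φ₂) :=
  fun ι => cuspH₀_archTensor₂ L m φ₂ ι (hφ _)

/-- The two-factor pure tensor with its `u`-component replaced by a trace-cuspidal `ψ` (other factors trace-cuspidal) is `CuspH₀ L m ι` at every `ι`.
[cite: Rogawski1990, §13.8 p. 218 L20–28] -/
theorem cuspH₀_archTensor₂_update [DecidableEq {w : InfinitePlace L // w.IsComplex}] (m : ArchOrbFamH L)
    (φ₂ : ∀ w : {w : InfinitePlace L // w.IsComplex}, C_c(↥(archLocal L 2 (phi2 L) w) × ↥(archLocal L 1 (phi1 L) w), ℂ)) (u : {w : InfinitePlace L // w.IsComplex})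
    (ψ : C_c(↥(archLocal L 2 (phi2 L) u) × ↥(archLocal L 1 (phi1 L) u), ℂ)) (hψ : IsArchTraceCuspidal ψ) (hφ : ∀ w, w ≠ u → IsArchTraceCuspidal (φ₂ w))
    (ι : L →+* ℂ) : CuspH₀ L m ι ⇑(archTensor₂ L (phi2 L) (phi1 L) (Function.update φ₂ u ψ)) :=
  cuspH₀_archTensor₂ L m (Function.update φ₂ u ψ) ι (isArchTraceCuspidal_update φ₂ u ψ hψ hφ (embPlace L ι))

/-- At the surgery place itself only `ψ` is read (witness `fτ := ψ`, ★ `archTensor₂_update_factorsAt`). [cite: Rogawski1990, §13.8 p. 218 L20–28] -/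
theorem cuspH₀_archTensor₂_update_self [DecidableEq {w : InfinitePlace L // w.IsComplex}] (m : ArchOrbFamH L)
    (φ₂ : ∀ w : {w : InfinitePlace L // w.IsComplex}, C_c(↥(archLocal L 2 (phi2 L) w) × ↥(archLocal L 1 (phi1 L) w), ℂ)) (ι : L →+* ℂ)
    (ψ : C_c(↥(archLocal L 2 (phi2 L) (embPlace L ι)) × ↥(archLocal L 1 (phi1 L) (embPlace L ι)), ℂ)) (hψ : IsArchTraceCuspidal ψ) :
    CuspH₀ L m ι ⇑(archTensor₂ L (phi2 L) (phi1 L) (Function.update φ₂ (embPlace L ι) ψ)) :=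
  ⟨ψ, archTensorAway₂ L (phi2 L) (phi1 L) φ₂ (embPlace L ι), archTensor₂_update_factorsAt L (phi2 L) (phi1 L) φ₂ (embPlace L ι) ψ, hψ⟩

/-- **A4 — ONE-PLACE DIFFERENCES OF TWO-FACTOR PURE TENSORS ARE `CuspH₀`** (print's `f^H` chosen among differences of pseudo-coefficient combinations at one place,
Prop. 12.3.2): `⇑(fH₁ - fH₂)` is `CuspH₀ L m ι` at every `ι` when `ψ₁ − ψ₂` and the common factors are trace-cuspidal (★ `archTensor₂_update_sub` then A3).
[cite: Rogawski1990, §12.3 Prop. 12.3.2 p. 178; §13.8 p. 218 L20–28] [cite: Arthur1988InvariantTraceFormulaII, §7 p. 538] -/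
theorem cuspH₀_archTensor₂_update_sub [DecidableEq {w : InfinitePlace L // w.IsComplex}] (m : ArchOrbFamH L)
    (φ₂ : ∀ w : {w : InfinitePlace L // w.IsComplex}, C_c(↥(archLocal L 2 (phi2 L) w) × ↥(archLocal L 1 (phi1 L) w), ℂ)) (u : {w : InfinitePlace L // w.IsComplex})
    (ψ₁ ψ₂ : C_c(↥(archLocal L 2 (phi2 L) u) × ↥(archLocal L 1 (phi1 L) u), ℂ)) (hψ : IsArchTraceCuspidal (ψ₁ - ψ₂))
    (hφ : ∀ w, w ≠ u → IsArchTraceCuspidal (φ₂ w)) (ι : L →+* ℂ) :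
    CuspH₀ L m ι ⇑(archTensor₂ L (phi2 L) (phi1 L) (Function.update φ₂ u ψ₁) - archTensor₂ L (phi2 L) (phi1 L) (Function.update φ₂ u ψ₂)) := by
  rw [archTensor₂_update_sub]
  exact cuspH₀_archTensor₂_update L m φ₂ u (ψ₁ - ψ₂) hψ hφ ι

/-- A4 at the surgery place itself: only `ψ₁ − ψ₂` is read. [cite: Rogawski1990, §13.8 p. 218 L20–28] -/
theorem cuspH₀_archTensor₂_update_sub_self [DecidableEq {w : InfinitePlace L // w.IsComplex}] (m : ArchOrbFamH L)
    (φ₂ : ∀ w : {w : InfinitePlace L // w.IsComplex}, C_c(↥(archLocal L 2 (phi2 L) w) × ↥(archLocal L 1 (phi1 L) w), ℂ)) (ι : L →+* ℂ)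
    (ψ₁ ψ₂ : C_c(↥(archLocal L 2 (phi2 L) (embPlace L ι)) × ↥(archLocal L 1 (phi1 L) (embPlace L ι)), ℂ)) (hψ : IsArchTraceCuspidal (ψ₁ - ψ₂)) :
    CuspH₀ L m ι ⇑(archTensor₂ L (phi2 L) (phi1 L) (Function.update φ₂ (embPlace L ι) ψ₁) - archTensor₂ L (phi2 L) (phi1 L) (Function.update φ₂ (embPlace L ι) ψ₂)) := by
  rw [archTensor₂_update_sub]
  exact cuspH₀_archTensor₂_update_self L m φ₂ ι (ψ₁ - ψ₂) hψ

end HSide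

end Summit.HodgeConjecture.HodgeConjecture.R90.S2

end
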